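import Summits.QuantumFields.YangMills.Theorems.FlatTubeReductionBOAssemblyRate
import Summits.QuantumFields.YangMills.Theorems.FlatTubeReductionDressedNearTop
import Summits.QuantumFields.YangMills.Theorems.LuscherReductionTwistedTraceScalingRecordBricks
import HarnessLib

/-!
# K1 from the ANALYTIC rate bricks alone: the structural fields of `BORateBricks` for the record weight, discharged — rate twin of lane A's `…RecordBricks`
# (route `FlatTubeReduction`, crux K1 `NearFlatRatioLaw` stmt-QuantumFields-24720; seat `ym-line-ftr-p1` g9; R2b1 RECORD rung — no summit statement is proved here)

`RecordBORateInput L s K M` = what the pooled rate-twin seat must SUPPLY for the record weight `χ = recordChi L s K M = recordWeightRho (Kβ^{-s}) (MKβ^{-s}) β^{-1}` (lane A, p650161):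
an ADAPTED EQUIVARIANT fibre profile family `Ω β u v` (jointly measurable, `|Ω| ≤ 1`, supported in `{‖v‖ ≤ r β}`), a DRESSED weight `W β u` (`0 ≤ W ≤ 1`, gauge invariant) with its
VACUUM BEHAVIOUR `1 ≤ W²(1 + κ_W‖zm‖²)` on {all-upper} ∩ {orbitDist < √λ_b(L³β)}, a slow radius `δ₁` with lane A's SHADOW property (S1) and `√λ_b(L³β) ≤ δ₁` eventually, the
radii inequality, rates `κ, b` with `κ, b² = O(λ_b²)`, `σ, γ > 0`, `θ₀ ∈ (0,1]`, the fibre-mass brick (B-N) on the window (normalise `Ω_u` fibrewise — at the inner scale `s = 1/40`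
the FP-weight variation `O(β^{-2s})` is NOT `O(λ_b²)`, so (P) cannot supply (B-N) at rate grade; normalisation makes it exact), and the three ANALYTIC bricks (B-T)-RATE (against the
dressed one-site form), (B-ST), (B-OD) (`b² = O(λ_b²)`).
* `boFunAd_support_record` — `BORateBricks.hbo` for the record weight (lane A's `boFun_support_record` with the adapted profile);
* ★★★ `boRateBricks_record : RecordBORateInput L s K M → BORateBricks L (recordChi L s K M) β^{-s}` — ALL structural fields + `hTop` (`dressed_near_top`, p652213) discharged;
* ★★★★ `nearFlatRatioLaw_of_recordRateInput` (K1 24720) and `femtoGapFixedLattice_of_recordRateInput` (FCL 23943): `∀ L ≥ 2, RecordBORateInput L (1/40) 3 M` (`M ≥ 2`) suffices.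
HONEST FRAMING: the rate twin of C4-CORE is now EXACTLY the construction of (Ω, W) + (B-N by normalisation) + (B-T)-rate + (B-ST) + (B-OD) (+ (S1), lane A's `recordChi_shadow`);
those are OPEN (pooled with RED lane A, crux 20203); femto rung R2b1 (RECORD label); not infinite volume, not a gap, not Clay.  One `structure`, one `def`-free instance, no `sorry`.
-/

set_option autoImplicit false

noncomputable section

open MeasureTheory Filter Topology Real
open scoped BigOperators
open Literature.MathematicalPhysics.QuantumFieldTheory
open Literature.MathematicalPhysics.QuantumLattice

namespace Summit.QuantumFields.YangMills.Theorems.FemtoTransferGap.RateTube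

open Summit.QuantumFields.YangMills.Theorems.FemtoTransferGap
open Summit.QuantumFields.YangMills.Theorems.FemtoTransferGap.TwoLattice.Avg
open Summit.QuantumFields.YangMills.Theorems.FemtoTransferGap.TwoLattice.ConstTube
open Summit.QuantumFields.YangMills.Theorems.FemtoTransferGap.TwoLattice.Stiff (LinkSpace)
open Summit.QuantumFields.YangMills.Theorems.FemtoCutoffLadder

variable {L : ℕ} [NeZero L]

/-! ## §1 BO supports for the record weight (adapted profile) -/

/-- ★★ **`BORateBricks.hbo` for the record weight**: an adapted BO function with amplitude supported in `{orbitDist₁ < δ₁}` and profile in `{‖x‖ ≤ r}` (for every slow point)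
is supported in `supp (recordWeightRho δ' ρ δg β) ∩ {orbitDist < |Edge|(4r + δ₁)}`. [folklore] -/
theorem boFunAd_support_record {δ' ρ δg : ℝ → ℝ} {β : ℝ} {φ : GaugeConfig 3 1 SU2 → ℝ} {δ₁ : ℝ} (hφ : ∀ u, φ u ≠ 0 → orbitDist u < δ₁)
    {Ω : GaugeConfig 3 1 SU2 → LinkSpace L → ℝ} {r : ℝ} (hr : r ≤ 1 / 2) (hΩ : ∀ u x, Ω u x ≠ 0 → ‖x‖ ≤ r) (hρ : 4 * r + δ₁ < ρ β)
    (hδ' : Fintype.card (Edge 3 L) * (4 * r + δ₁) < δ' β) {U : GaugeConfig 3 L SU2} (hU : boFunAd L φ Ω U ≠ 0) :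
    recordWeightRho L δ' ρ δg β U ≠ 0 ∧ orbitDist U < Fintype.card (Edge 3 L) * (4 * r + δ₁) := by
  obtain ⟨hUt, hφU, hΩU⟩ := boFunAd_ne_zero L hU
  obtain ⟨u, v, hvc, rfl⟩ := hUt
  rw [slowMean_orthoTube L u hvc] at hφU hΩU
  rw [relLinkVec_orthoTube L u hvc] at hΩU
  have hu : orbitDist u ≤ δ₁ := (hφ u hφU).le
  have hve : ∀ e, ‖v e‖ ≤ r := fun e => (norm_apply_le_norm_linkEmbed v e).trans (hΩ _ _ hΩU)
  have hcard : (0 : ℝ) < Fintype.card (Edge 3 L) := by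
    have : 0 < Fintype.card (Edge 3 L) := Fintype.card_pos_iff.mpr ⟨((fun _ => 0), 0)⟩
    exact_mod_cast this
  refine ⟨?_, ?_⟩
  · have hmem : orthoTube L u v ∈ fatTubeRho L δ' ρ β := ⟨orthoTube_mem_nearOne hu hr hve hρ, (orbitDist_orthoTube_le hu hr hve).trans_lt hδ'⟩
    unfold recordWeightRho
    rw [Set.indicator_of_mem hmem, one_mul]
    exact (Real.exp_pos _).ne'
  · have hu' : orbitDist u < δ₁ := hφ u hφU
    obtain ⟨δ₀, hδ₀u, hδ₀⟩ := exists_between hu'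
    calc orbitDist (orthoTube L u v) ≤ Fintype.card (Edge 3 L) * (4 * r + δ₀) := orbitDist_orthoTube_le hδ₀u.le hr hve
      _ < Fintype.card (Edge 3 L) * (4 * r + δ₁) := by nlinarith

/-! ## §2 The input a successor must supply (rate grade) -/

variable (L) in
/-- **THE RATE-GRADE INPUT FOR THE RECORD WEIGHT** (see the module docstring). [cite: Luscher1983, §3] [cite: SjostrandZworski2007, §2] -/
structure RecordBORateInput (s K M : ℝ) where
  /-- adapted equivariant fibre profile, dressed weight, radii, rates and constants -/
  Ω : ℝ → GaugeConfig 3 1 SU2 → LinkSpace L → ℝ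
  W : ℝ → GaugeConfig 3 1 SU2 → ℝ
  r : ℝ → ℝ
  δ₁ : ℝ → ℝ
  σ : ℝ → ℝ
  γ : ℝ → ℝ
  κ : ℝ → ℝ
  b : ℝ → ℝ
  θ₀ : ℝ
  κW : ℝ
  hΩm : ∀ β, Measurable (Function.uncurry (Ω β))
  hΩ1 : ∀ β u x, |Ω β u x| ≤ 1
  hΩinv : ∀ β (g : SU2) (u : GaugeConfig 3 1 SU2) (v : LinkSpace L), Ω β (gaugeTransform (fun _ : Site 3 1 => g) u) (adL L g v) = Ω β u v
  hΩr : ∀ β u x, Ω β u x ≠ 0 → ‖x‖ ≤ r β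
  hWm : ∀ β, Measurable (W β)
  hW0 : ∀ β u, 0 ≤ W β u
  hW1 : ∀ β u, W β u ≤ 1
  hWinv : ∀ β (g : Site 3 1 → SU2) (u : GaugeConfig 3 1 SU2), W β (gaugeTransform g u) = W β u
  hκW : 0 ≤ κW
  /-- the VACUUM BEHAVIOUR of the dressed weight (`W² = e^{−V}`, `V = O(‖zm‖²)`) on the support of the quasimode -/
  hWvac : ∀ᶠ β in atTop, ∀ u : GaugeConfig 3 1 SU2, (∀ e : Edge 3 1, 0 < scalarPart (u e)) → orbitDist u < Real.sqrt (bareLambda ((L : ℝ) ^ 3 * β)) →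
    0 < W β u ∧ W β u ≤ 1 ∧ 1 ≤ W β u ^ 2 * (1 + κW * ‖zmCoord 1 u‖ ^ 2)
  hr : ∀ β, 0 ≤ r β ∧ r β ≤ 1 / 2
  hγ : ∀ β, 0 < γ β
  hδ₁ : ∀ᶠ β in atTop, δ₁ β ≤ 1 / 2
  hcoreR : ∀ᶠ β in atTop, Real.sqrt (bareLambda ((L : ℝ) ^ 3 * β)) ≤ δ₁ β
  hradii : ∀ᶠ β in atTop, (Fintype.card (Edge 3 L) : ℝ) * (4 * r β + δ₁ β) < K * powScale s β
  /-- (S1) the slow shadow of the test support (lane A's `recordChi_shadow`) -/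
  hshadow : ∀ᶠ β in atTop, ∀ U : GaugeConfig 3 L SU2, recordChi L s K M β U ≠ 0 → orbitDist U < powScale s β → orbitDist (slowMean L U) < δ₁ β
  hσ : ∀ β, 0 < σ β
  hκ0 : ∀ β, 0 ≤ κ β
  hκ_small : ∃ a : ℝ, ∀ᶠ β in atTop, κ β ≤ a * bareLambda ((L : ℝ) ^ 3 * β) ^ 2
  hb : ∀ β, 0 ≤ b β
  hb_small : ∃ a : ℝ, ∀ᶠ β in atTop, b β ^ 2 ≤ a * bareLambda ((L : ℝ) ^ 3 * β) ^ 2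
  hθ₀ : 0 < θ₀ ∧ θ₀ ≤ 1
  /-- (B-N) the fibre mass of the adapted profile on the window (exact after fibrewise normalisation) -/
  hN : ∀ᶠ β in atTop, ∀ u : GaugeConfig 3 1 SU2, orbitDist u < δ₁ β → |fibreMassAd L (softWeight (recordChi L s K M β)) (Ω β) u - γ β| ≤ κ β * γ β
  /-- (B-T)-RATE the kernel on adapted BO functions against the DRESSED one-site form -/
  hT : ∀ᶠ β in atTop, ∀ φ : GaugeConfig 3 1 SU2 → ℝ, Measurable φ → (∃ C : ℝ, ∀ u, |φ u| ≤ C) →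
    (∀ (g : Site 3 1 → SU2) (u : GaugeConfig 3 1 SU2), φ (gaugeTransform g u) = φ u) → (∀ u, φ u ≠ 0 → orbitDist u < δ₁ β) →
    |tubeForm β (boFunAd L φ (Ω β)) - σ β * γ β * qform su2Rep ((L : ℝ) ^ 3 * β) (fun u => φ u * W β u) (fun u => φ u * W β u)| ≤
      κ β * (σ β * γ β) * (qform su2Rep ((L : ℝ) ^ 3 * β) (fun u => φ u * W β u) (fun u => φ u * W β u) + levelValue su2Rep 1 ((L : ℝ) ^ 3 * β) 0 * l2 φ φ)
  /-- (B-ST) stiff domination -/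
  hST : ∀ᶠ β in atTop, ∀ v : GaugeConfig 3 L SU2 → ℝ, Measurable v → (∃ C : ℝ, ∀ U, |v U| ≤ C) → (∀ U, v U ≠ 0 → recordChi L s K M β U ≠ 0) →
    (∀ u, fibreInnerAd L (softWeight (recordChi L s K M β)) (Ω β) v u = 0) →
    tubeForm β v ≤ (1 - θ₀) * (σ β * levelValue su2Rep 1 ((L : ℝ) ^ 3 * β) 0) * tubeNormSq (softWeight (recordChi L s K M β)) v
  /-- (B-OD) off-diagonal, `b² = O(λ_b²)` -/
  hOD : ∀ᶠ β in atTop, ∀ (φ : GaugeConfig 3 1 SU2 → ℝ) (v : GaugeConfig 3 L SU2 → ℝ), Measurable φ → (∃ C : ℝ, ∀ u, |φ u| ≤ C) →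
    (∀ u, φ u ≠ 0 → orbitDist u < δ₁ β) → Measurable v → (∃ C : ℝ, ∀ U, |v U| ≤ C) → (∀ U, v U ≠ 0 → recordChi L s K M β U ≠ 0) →
    (∀ u, fibreInnerAd L (softWeight (recordChi L s K M β)) (Ω β) v u = 0) →
    |tubeCross β (boFunAd L φ (Ω β)) v| ≤ b β * (σ β * levelValue su2Rep 1 ((L : ℝ) ^ 3 * β) 0) *
        Real.sqrt (tubeNormSq (softWeight (recordChi L s K M β)) (boFunAd L φ (Ω β))) * Real.sqrt (tubeNormSq (softWeight (recordChi L s K M β)) v) ∧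
    |tubeCross β v (boFunAd L φ (Ω β))| ≤ b β * (σ β * levelValue su2Rep 1 ((L : ℝ) ^ 3 * β) 0) *
        Real.sqrt (tubeNormSq (softWeight (recordChi L s K M β)) (boFunAd L φ (Ω β))) * Real.sqrt (tubeNormSq (softWeight (recordChi L s K M β)) v)

/-! ## §3 ★★★ The rate brick list for the record weight -/

/-- ★★★ **`BORateBricks` FOR THE RECORD WEIGHT from the rate input**: all structural fields and `hTop` discharged (lane A's `boBricks_record` verbatim for the structure;
`dressed_near_top` for `hTop`). [cite: Luscher1983, §3] -/
def boRateBricks_record {s K M : ℝ} (hs : 0 < s) (hM : 1 ≤ M) (I : RecordBORateInput L s K M) :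
    BORateBricks L (recordChi L s K M) (powScale s) where
  Ω := I.Ω
  W := I.W
  𝒰 := fun β => {u | orbitDist u < I.δ₁ β}
  σ := I.σ
  γ := I.γ
  κ := I.κ
  b := I.b
  c := fun β => Real.exp (-((Fintype.card (Edge 3 L) : ℝ) / powScale 1 β ^ 2))
  θ₀ := I.θ₀
  δ₁ := I.δ₁
  δ₂ := fun β => (Fintype.card (Edge 3 L) : ℝ) * (4 * I.r β + I.δ₁ β)
  m := 1 / (2 * L)
  hχm := fun β => (recordChi_props s K M β).1
  hχ1 := fun β => (recordChi_props s K M β).2.1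
  hχ0 := fun β => (recordChi_props s K M β).2.2.1
  hc := fun β => ⟨Real.exp_pos _, fun U hU => ((recordChi_props s K M β).2.2.2 U hU).1⟩
  hwm := fun β => (softWeight_recordChi_props s K M β).1
  hwb := fun β => ⟨_, (softWeight_recordChi_props s K M β).2.1⟩
  hw0 := fun β => (softWeight_recordChi_props s K M β).2.2.1
  hwinv := fun β => (softWeight_recordChi_props s K M β).2.2.2
  hΩm := I.hΩm
  hΩ1 := I.hΩ1
  hΩinv := I.hΩinv
  hWm := I.hWm
  hW0 := I.hW0
  hW1 := I.hW1
  hWinv := I.hWinv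
  h𝒰m := fun β => measurableSet_lt measurable_orbitDist measurable_const
  h𝒰inv := fun β g u => by simp only [Set.mem_setOf_eq, orbitDist_gaugeTransform]
  h𝒰δ₁ := fun β u hu => hu
  hδ₁ := I.hδ₁
  htube := by
    have hρ0 : Tendsto (fun β => M * (K * powScale s β)) atTop (𝓝 0) := by
      have := (tendsto_powScale hs).const_mul K |>.const_mul M; simpa using this
    filter_upwards [hρ0.eventually (gt_mem_nhds (show (0 : ℝ) < 1 / 5 by norm_num))] with β hρ U hU
    obtain ⟨-, hmem⟩ := (recordChi_props s K M β).2.2.2 U hU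
    have hlink : ∀ e : Edge 3 L, 1 - 1 / 50 ≤ scalarPart (U e) := fun e => by
      have h1 := hmem.1 e
      have h2 := frobNorm_sub_one_sq_eq_scalarPart (U e)
      have h3 : frobNorm (((U e : SU2) : Matrix (Fin 2) (Fin 2) ℂ) - 1) ^ 2 ≤ (1 / 5) ^ 2 :=
        pow_le_pow_left₀ (frobNorm_nonneg _) (h1.le.trans hρ.le) 2
      nlinarith [frobNorm_nonneg (((U e : SU2) : Matrix (Fin 2) (Fin 2) ℂ) - 1)]
    exact (mem_orthoTubeSet_of_near_one L (by norm_num) le_rfl hlink).2.1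
  hshadow := by filter_upwards [I.hshadow] with β hβ U hU hd; exact hβ U hU hd
  hbo := by
    filter_upwards [I.hradii] with β hrad φ U hφ hU
    have hr := I.hr β
    have hcard1 : (1 : ℝ) ≤ Fintype.card (Edge 3 L) := by
      have : 0 < Fintype.card (Edge 3 L) := Fintype.card_pos_iff.mpr ⟨((fun _ => 0), 0)⟩
      exact_mod_cast this
    have hpos : 0 ≤ 4 * I.r β + I.δ₁ β := by
      by_contra h; push Not at h
      obtain ⟨-, hφU, -⟩ := boFunAd_ne_zero L hU
      have h1 := hφ _ hφU; have h2 := orbitDist_nonneg (slowMean L U); linarith [hr.1]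
    have hρ : 4 * I.r β + I.δ₁ β < M * (K * powScale s β) := by
      have h1 : 4 * I.r β + I.δ₁ β ≤ (Fintype.card (Edge 3 L) : ℝ) * (4 * I.r β + I.δ₁ β) := by nlinarith
      have h2 : K * powScale s β ≤ M * (K * powScale s β) := by
        have := powScale_pos s β; nlinarith
      linarith
    exact boFunAd_support_record (δ' := fun β => K * powScale s β) (ρ := fun b => M * (K * powScale s b)) (δg := powScale 1) hφ hr.2 (I.hΩr β) hρ hrad hU
  hm := by positivity
  hm0 := by
    have hL0 : (0 : ℝ) < L := by exact_mod_cast Nat.pos_of_ne_zero (NeZero.ne L)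
    exact div_pos one_pos (by linarith)
  hδ₂ := by
    have hL0 : (0 : ℝ) < L := by exact_mod_cast Nat.pos_of_ne_zero (NeZero.ne L)
    have hρ0 : Tendsto (fun β => K * powScale s β) atTop (𝓝 0) := by
      have := (tendsto_powScale hs).const_mul K; simpa using this
    filter_upwards [I.hradii, hρ0.eventually (gt_mem_nhds (show (0 : ℝ) < 1 / L by positivity))] with β hrad hsmall
    have h1 : (L : ℝ) * ((Fintype.card (Edge 3 L) : ℝ) * (4 * I.r β + I.δ₁ β)) < L * (1 / L) := mul_lt_mul_of_pos_left (hrad.trans hsmall) hL0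
    rw [mul_one_div_cancel hL0.ne'] at h1
    have h2 : (L : ℝ) * (1 / (2 * L)) = 1 / 2 := by field_simp
    calc (L : ℝ) * ((Fintype.card (Edge 3 L) : ℝ) * (4 * I.r β + I.δ₁ β) + 1 / (2 * L))
        = (L : ℝ) * ((Fintype.card (Edge 3 L) : ℝ) * (4 * I.r β + I.δ₁ β)) + L * (1 / (2 * L)) := by ring
      _ < 1 + 1 / 2 := by rw [h2]; linarith
      _ < 2 := by norm_num
  hσ := I.hσ
  hγ := I.hγ
  hκ := I.hκ0
  hb := I.hb
  hθ₀ := I.hθ₀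
  hκ_small := I.hκ_small
  hb_small := I.hb_small
  hTop := by
    obtain ⟨C'', B₀, -, hD⟩ := dressed_near_top (κW := I.κW) I.hκW
    have hL1 : (1 : ℝ) ≤ (L : ℝ) ^ 3 := one_le_pow₀ (by exact_mod_cast NeZero.one_le)
    refine ⟨C'', ?_⟩
    filter_upwards [I.hWvac, I.hcoreR, Filter.eventually_ge_atTop (max B₀ 0)] with β hWv hcore hβ
    have hβ0 : 0 ≤ β := (le_max_right _ _).trans hβ
    have hB : B₀ ≤ (L : ℝ) ^ 3 * β := ((le_max_left _ _).trans hβ).trans (by nlinarith)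
    exact hD ((L : ℝ) ^ 3 * β) hB (I.W β) (I.hWm β) (I.hWinv β) hWv {u | orbitDist u < I.δ₁ β} fun u _ hu => lt_of_lt_of_le hu hcore
  hN := by filter_upwards [I.hN] with β hβ u hu; exact hβ u hu
  hT := by filter_upwards [I.hT] with β hβ φ h1 h2 h3 h4; exact hβ φ h1 h2 h3 h4
  hST := I.hST
  hOD := by filter_upwards [I.hOD] with β hβ φ v h1 h2 h3 h4 h5 h6 h7; exact hβ φ v h1 h2 h3 h4 h5 h6 h7

/-! ## §4 ★★★★ The two cruxes from the rate input -/

/-- The record weight at `K = 3` is admissible at the inner radius `β^{-s}` (`M ≥ 2`). [folklore] -/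
theorem softTubeAdmissible_recordChi (s M : ℝ) (hM : 2 ≤ M) : SoftTubeAdmissible L (powScale s) (recordChi L s 3 M) := by
  refine softTubeAdmissible_mono (δ' := fun β => 3 * powScale s β) (fun β => by linarith [powScale_pos s β]) ?_
  show SoftTubeAdmissible L (fun β => 3 * powScale s β) (recordWeightRho L (fun β => 3 * powScale s β) (fun b => M * (3 * powScale s b)) (powScale 1))
  exact softTubeAdmissible_recordWeightRho L (fun β => by linarith [powScale_pos s β]) (fun β => by nlinarith [powScale_pos s β])

/-- ★★★★ **K1 `NearFlatRatioLaw` ⇐ the rate input for the record weight** (`K = 3`, `M ≥ 2`, `s = 1/40`) on every `L ≥ 2`. [cite: Luscher1983, §3] -/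
theorem nearFlatRatioLaw_of_recordRateInput (M : ℝ) (hM : 2 ≤ M) (I : ∀ (L : ℕ) [NeZero L], 2 ≤ L → RecordBORateInput L (1 / 40) 3 M) :
    Summit.QuantumFields.YangMills.Theses.FlatTubeReduction.NearFlatRatioLaw :=
  Summit.QuantumFields.YangMills.Theorems.FlatTubeReduction.nearFlatRatioLaw_of_innerRate fun L _ hL =>
    innerRateAt_of_ratePackage (L := L) 1 (fun β => powScale_pos (1 / 40) β) powScale_fortieth_eventually_le
      (softTubeAdmissible_recordChi (1 / 40) M hM) (softTubeBORatePackageOn_of_rateBricks (boRateBricks_record (by norm_num) (by linarith) (I L hL)))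

/-- ★★★★ **FCL 23943 `FemtoGapFixedLattice` ⇐ the rate input for the record weight**, likewise (`L = 1` is crux ONE). [cite: Luscher1983, §3] -/
theorem femtoGapFixedLattice_of_recordRateInput (M : ℝ) (hM : 2 ≤ M) (I : ∀ (L : ℕ) [NeZero L], 2 ≤ L → RecordBORateInput L (1 / 40) 3 M) :
    FemtoGapFixedLattice := by
  intro L _
  by_cases hL : 2 ≤ L
  · exact femtoGapFixedLatticeAt_of_valley_innerRate (L := L) (p := 1 / 40) (q := 17 / 20) (by norm_num) (by norm_num) (by norm_num)
      (valleyGainAt_ledger hL)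
      (innerRateAt_of_ratePackage (L := L) 1 (fun β => powScale_pos (1 / 40) β) powScale_fortieth_eventually_le
        (softTubeAdmissible_recordChi (1 / 40) M hM) (softTubeBORatePackageOn_of_rateBricks (boRateBricks_record (by norm_num) (by linarith) (I L hL))))
  · have hL1 : L = 1 := by
      have h0 : L ≠ 0 := NeZero.ne L
      omega
    subst hL1
    exact femtoGapOneSite_proof

end Summit.QuantumFields.YangMills.Theorems.FemtoTransferGap.RateTube

end
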